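import Summits.Ventures.GridStability.Lyapunov.NE39LLffLevel
import Summits.Ventures.GridStability.Lyapunov.WSCC9LffLevel
import HarnessLib

/-!
# GridStability/Lyapunov/LffLevelNonempty — the explicit-level LFF rows are NOT vacuous: the equilibrium
# lies in the polytope and its value `V(0)` is BELOW every certified level constant (kernel inequalities)

Cell `gridfusion` (LADDER-GRIDFUSION), LFF lane; lead ASK 2026-08-27T04:06:02Z «non-emptiness rider of the
LEVEL rows — is there a kernel decl giving V(equilibrium) below the level bound for NE39L / WSCC9L …?»
(ref-1 row 135 caveat «the level sentences do not assert non-emptiness»). Seat gridfusion-lyap-1 (g4);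
namespaces `Summit.Ventures.GridStability.Lyapunov.RelativeLff` (generic), `…NE39LLff`, `…WSCC9Lff`.

WHY. The explicit-level theorems (`RelativeLff.wellU_subset_regionOfAttraction_of_level` p493112,
`NE39LLff.levelU_roa` / `oso_level_roa` p493380, `WSCC9Lff.level_roa` / `levelU_roa` p493809) quantify
«every `y ∈ 𝒫` with `V y ≤ c₀`» for every `c₀` below a rational level `c′·L`; they never say that such a `y`
exists. lit-6's `Certificate.V_zero` gives `V(0) = −Σ_k K_k (cos δ*_k + δ*_k sin δ*_k)` symbolically, and
model-1's consumer bound `eqTermHi` (p491061) is an UPPER bound of `cos δ* + δ* sin δ*`, i.e. a LOWER bound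
of `V(0)` — the wrong side. HERE: the mirror LOWER bound `eqTermLo := cd + lineLo·|sd| ≤ cos δ* + δ* sin δ*`
(exact rational `cos δ*`, `|sin δ*|` from the circle points, model-1's `lineLo` from the node tables), hence
`V(0) ≤ −c′·Σ_k w_k·eqTermLo_k`, and ONE decidable rational comparison `−Σ w·eqTermLo < L` per certificate gives
**`V(0) < c′·L`**: the interval of admissible levels containing the equilibrium value is non-empty, and for
every `c₀ ∈ [V(0), c′·L)` the certified set `{y ∈ 𝒫 | V y ≤ c₀}` contains the equilibrium `0`
(`zero_mem_polytope_of_abs_lt`: `|δ*_k| < π/2 ⇒ 0 ∈ 𝒫`).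
INSTANCES (all `decide +kernel` over `ℚ`, tables = the ones already certified in p493380 / p492027):
* NE39L closed form, every `λ > 0`: `NE39LLff.V_zero_lt_levelU : (certU λ).V 0 < (2/λ + λ/2)·L_U`
  (`−Σ C·eqTermLo = −67.69…  < −67.244`; at `λ = 1/10`: `V(0) ≈ −1357.3 < −1348.24`);
* NE39L certificate OF RECORD cedb541c (λ = 1/10): `NE39LLff.oso_V_zero_lt_level : cert.V 0 < L_oso = −467.416`
  (sos-4 float `V0 ≈ −470.6`);
* WSCC9L certificate of record P1 (ordered pairs): `WSCC9Lff.V_zero_lt_level :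
  (cert λ).V 0 < (2/λ + λ/2)·(1657/10000 − 72029/20000)`; 3-line closed form: `WSCC9Lff.V_zero_lt_levelU :
  (certU λ).V 0 < (2/λ + λ/2)·L_U`;
* `…zero_mem_polytope…` for each presentation, and the packaged riders `…level_nonempty…`:
  `∃ c₀ < c′·L, 0 ∈ 𝒫 ∧ V 0 ≤ c₀` (witness `c₀ = V 0`).
THREE COLUMNS. CERTIFIED: these kernel inequalities about MODEL M′ (tokens as in the level files: NE39L =
«synthetic lossless redispatched uniform-λ VARIANT — not a New England sentence», MV-2L + MV-RD + MV-λ + MV-h12;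
WSCC9L = «synthetic lossless uniform-λ VARIANT of the printed 9-bus», MV-2L + MV-RD + MV-λ + MV-h12).
VALIDATED / MODELLED: nothing new. No sentence here says that any grid is stable. One bookkeeping `def`
(`eqTermLo`, + `woq`); no named fact; standard axioms.
-/

noncomputable section

open Set Filter Topology Real Finset
open Literature.MathematicalPhysics.PowerSystems
open Literature.MathematicalPhysics.PowerSystems.LyapunovFunctionFamily
open Literature.MathematicalPhysics.PowerSystems.ClassicalModel.LosslessSystem (vtGap)
open Summit.Ventures.GridStability.Models
open Summit.Ventures.GridStability.Models.AngleEnclosure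

namespace Summit.Ventures.GridStability.Lyapunov.RelativeLff

/-! ### Generic: the equilibrium is in the polytope; the lower equilibrium-term bound -/

/-- **The equilibrium `0` lies in the Vu–Turitsyn polytope** `𝒫 = {|δ*_k + (Cx)_k + δ*_k| < π}` of any
system whose equilibrium channel angles satisfy `|δ*_k| < π/2`. [folklore] -/
theorem zero_mem_polytope_of_abs_lt {ι κ : Type*} [Fintype ι] [Fintype κ] (S : System ι κ)
    (h : ∀ k, |S.δs k| < π / 2) : (0 : ι → ℝ) ∈ S.polytope := by
  intro k
  rw [Matrix.mulVec_zero, Pi.zero_apply, add_zero]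
  have hk := h k
  rw [abs_lt] at hk ⊢
  constructor <;> linarith

/-- **Rational LOWER bound for the equilibrium term of `V(0)`** (mirror of model-1's
`cos_add_mul_sin_le_of_bounds`): with `cos x = cd`, `|sin x| = as` and `L ≤ |x|` (`|x| ≤ π`):
`cd + L·as ≤ cos x + x sin x`. [folklore] -/
theorem cos_add_mul_sin_ge_of_bounds {x cd as L : ℝ} (hx : |x| ≤ π) (hcos : cos x = cd)
    (hsin : |sin x| = as) (hL : L ≤ |x|) : cd + L * as ≤ cos x + x * sin x := by
  rw [mul_sin_eq_abs_mul_abs_sin hx, hsin, hcos]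
  have has : 0 ≤ as := hsin ▸ abs_nonneg _
  nlinarith [mul_le_mul_of_nonneg_right hL has]

variable {n : ℕ} (d : RecastData n)

/-- Rational LOWER bound of the equilibrium term `cos δ* + δ* sin δ*` of `V(0)` from node tables:
`cd + lineLo·|sd|` (bookkeeping; mirror of model-1's `eqTermHi`). -/
def eqTermLo (lo hi : Fin (n + 1) → ℚ) (a b : Fin (n + 1)) : ℚ :=
  d.cd a b + lineLo lo hi a b * |d.sd a b|

/-- **`eqTermLo ≤ cos δ* + δ* sin δ*`** (`δ* = θ*_a − θ*_b`) for acute exact data and certified node tables.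
[folklore] -/
theorem eqTermLo_le (hE : d.EqData d.angleOf) (hc : ∀ i, 0 < d.c i) {lo hi : Fin (n + 1) → ℚ}
    (hlo : ∀ i, (lo i : ℝ) ≤ d.angleOf i) (hhi : ∀ i, d.angleOf i ≤ (hi i : ℝ)) (a b : Fin (n + 1)) :
    ((eqTermLo d lo hi a b : ℚ) : ℝ) ≤
      cos (d.angleOf a - d.angleOf b) + (d.angleOf a - d.angleOf b) * sin (d.angleOf a - d.angleOf b) := by
  have key := cos_add_mul_sin_ge_of_bounds (d.abs_angleOf_sub_lt_pi (hc a) (hc b)).le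
    (d.cos_angleOf_sub hE a b) (d.abs_sin_angleOf_sub hE a b) (lineLo_le_abs_sub hlo hhi a b)
  push_cast [eqTermLo] at key ⊢
  linarith

/-- **Weighted sums, unordered lines**: `Σ_k w_k·eqTermLo_k ≤ Σ_k w_k (cos δ*_k + δ*_k sin δ*_k)` for
nonnegative rational weights (the left side is a rational number). [folklore] -/
theorem sum_w_eqTermLo_le_line (hE : d.EqData d.angleOf) (hc : ∀ i, 0 < d.c i) {lo hi : Fin (n + 1) → ℚ}
    (hlo : ∀ i, (lo i : ℝ) ≤ d.angleOf i) (hhi : ∀ i, d.angleOf i ≤ (hi i : ℝ))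
    (w : RecastData.LffLine n → ℚ) (hw : ∀ k, 0 ≤ w k) :
    ((∑ k : RecastData.LffLine n, w k * eqTermLo d lo hi k.1.1 k.1.2 : ℚ) : ℝ) ≤
      ∑ k : RecastData.LffLine n, (w k : ℝ) * (cos (RecastData.lffδsu d.angleOf k)
        + RecastData.lffδsu d.angleOf k * sin (RecastData.lffδsu d.angleOf k)) := by
  push_cast
  exact Finset.sum_le_sum fun k _ =>
    mul_le_mul_of_nonneg_left (eqTermLo_le d hE hc hlo hhi k.1.1 k.1.2) (by exact_mod_cast hw k)

/-- **Weighted sums, ordered off-diagonal pairs.** [folklore] -/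
theorem sum_w_eqTermLo_le_pair (hE : d.EqData d.angleOf) (hc : ∀ i, 0 < d.c i) {lo hi : Fin (n + 1) → ℚ}
    (hlo : ∀ i, (lo i : ℝ) ≤ d.angleOf i) (hhi : ∀ i, d.angleOf i ≤ (hi i : ℝ))
    (w : RecastData.LffPair n → ℚ) (hw : ∀ k, 0 ≤ w k) :
    ((∑ k : RecastData.LffPair n, w k * eqTermLo d lo hi k.1.1 k.1.2 : ℚ) : ℝ) ≤
      ∑ k : RecastData.LffPair n, (w k : ℝ) * (cos (RecastData.lffδso d.angleOf k)
        + RecastData.lffδso d.angleOf k * sin (RecastData.lffδso d.angleOf k)) := by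
  push_cast
  exact Finset.sum_le_sum fun k _ =>
    mul_le_mul_of_nonneg_left (eqTermLo_le d hE hc hlo hhi k.1.1 k.1.2) (by exact_mod_cast hw k)

/-- **From ONE rational comparison to the upper bound of `V(0)` (lines)**: if `K = c′·w` with `c′ > 0` and
`−Σ_k w_k·eqTermLo_k < L`, then `−Σ_k c′ w_k (cos δ*_k + δ*_k sin δ*_k) < c′·L`. [folklore] -/
theorem neg_sum_lt_of_level_line (hE : d.EqData d.angleOf) (hc : ∀ i, 0 < d.c i) {lo hi : Fin (n + 1) → ℚ}
    (hlo : ∀ i, (lo i : ℝ) ≤ d.angleOf i) (hhi : ∀ i, d.angleOf i ≤ (hi i : ℝ))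
    (w : RecastData.LffLine n → ℚ) (hw : ∀ k, 0 ≤ w k) {c' : ℝ} (hc' : 0 < c') {L : ℚ}
    (hVL : -(∑ k : RecastData.LffLine n, w k * eqTermLo d lo hi k.1.1 k.1.2) < L) :
    -(∑ k : RecastData.LffLine n, c' * (w k : ℝ) * (cos (RecastData.lffδsu d.angleOf k)
        + RecastData.lffδsu d.angleOf k * sin (RecastData.lffδsu d.angleOf k))) < c' * (L : ℝ) := by
  have h1 := sum_w_eqTermLo_le_line d hE hc hlo hhi w hw
  have hVL' : -(((∑ k : RecastData.LffLine n, w k * eqTermLo d lo hi k.1.1 k.1.2 : ℚ) : ℝ)) < (L : ℝ) := by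
    have := (Rat.cast_lt (K := ℝ)).mpr hVL
    push_cast at this ⊢
    linarith
  have hs : ∑ k : RecastData.LffLine n, c' * (w k : ℝ) * (cos (RecastData.lffδsu d.angleOf k)
        + RecastData.lffδsu d.angleOf k * sin (RecastData.lffδsu d.angleOf k))
      = c' * ∑ k : RecastData.LffLine n, (w k : ℝ) * (cos (RecastData.lffδsu d.angleOf k)
        + RecastData.lffδsu d.angleOf k * sin (RecastData.lffδsu d.angleOf k)) := by
    rw [Finset.mul_sum]
    exact Finset.sum_congr rfl fun k _ => by ring
  rw [hs]
  have h2 : -(∑ k : RecastData.LffLine n, (w k : ℝ) * (cos (RecastData.lffδsu d.angleOf k)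
        + RecastData.lffδsu d.angleOf k * sin (RecastData.lffδsu d.angleOf k))) < (L : ℝ) := by
    linarith
  have h3 := mul_lt_mul_of_pos_left h2 hc'
  linarith

/-- **The same for ordered off-diagonal pairs.** [folklore] -/
theorem neg_sum_lt_of_level_pair (hE : d.EqData d.angleOf) (hc : ∀ i, 0 < d.c i) {lo hi : Fin (n + 1) → ℚ}
    (hlo : ∀ i, (lo i : ℝ) ≤ d.angleOf i) (hhi : ∀ i, d.angleOf i ≤ (hi i : ℝ))
    (w : RecastData.LffPair n → ℚ) (hw : ∀ k, 0 ≤ w k) {c' : ℝ} (hc' : 0 < c') {L : ℚ}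
    (hVL : -(∑ k : RecastData.LffPair n, w k * eqTermLo d lo hi k.1.1 k.1.2) < L) :
    -(∑ k : RecastData.LffPair n, c' * (w k : ℝ) * (cos (RecastData.lffδso d.angleOf k)
        + RecastData.lffδso d.angleOf k * sin (RecastData.lffδso d.angleOf k))) < c' * (L : ℝ) := by
  have h1 := sum_w_eqTermLo_le_pair d hE hc hlo hhi w hw
  have hVL' : -(((∑ k : RecastData.LffPair n, w k * eqTermLo d lo hi k.1.1 k.1.2 : ℚ) : ℝ)) < (L : ℝ) := by
    have := (Rat.cast_lt (K := ℝ)).mpr hVL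
    push_cast at this ⊢
    linarith
  have hs : ∑ k : RecastData.LffPair n, c' * (w k : ℝ) * (cos (RecastData.lffδso d.angleOf k)
        + RecastData.lffδso d.angleOf k * sin (RecastData.lffδso d.angleOf k))
      = c' * ∑ k : RecastData.LffPair n, (w k : ℝ) * (cos (RecastData.lffδso d.angleOf k)
        + RecastData.lffδso d.angleOf k * sin (RecastData.lffδso d.angleOf k)) := by
    rw [Finset.mul_sum]
    exact Finset.sum_congr rfl fun k _ => by ring
  rw [hs]
  have h2 : -(∑ k : RecastData.LffPair n, (w k : ℝ) * (cos (RecastData.lffδso d.angleOf k)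
        + RecastData.lffδso d.angleOf k * sin (RecastData.lffδso d.angleOf k))) < (L : ℝ) := by
    linarith
  have h3 := mul_lt_mul_of_pos_left h2 hc'
  linarith

/-- The half line weights over `ℚ` (ordered pairs): `w_k = C_ij/2`. -/
def woq (k : RecastData.LffPair n) : ℚ := d.Cc k.1.1 k.1.2 / 2

/-- `woq` casts to `lffWo`. -/
theorem woq_cast (k : RecastData.LffPair n) : ((woq d k : ℚ) : ℝ) = d.lffWo k := by
  show ((d.Cc k.1.1 k.1.2 / 2 : ℚ) : ℝ) = (d.Cc k.1.1 k.1.2 : ℝ) / 2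
  push_cast; ring

/-- **`V(0)` of the unordered-line closed form `certU` is below `c′·L`** whenever the node tables pass the
decidable tests and `−Σ_k C_k·eqTermLo_k < L` (one rational comparison). [folklore] -/
theorem certU_V_zero_lt_of_level (lam : ℚ) (hlam : 0 < lam) {ν : ℝ} (hν : 0 < ν) (hM : ∀ i, 0 < d.M i)
    (hνM : ∀ m, ν < Mμ d m) (hCS : ∑ m, Mμ d m ^ 2 / (Mμ d m - ν) ≤ S d)
    (hC : ∀ i j : Fin (n + 1), i ≠ j → 0 < d.Cc i j) (hE : d.EqData d.angleOf)
    (hcirc : ∀ i, d.s i ^ 2 + d.c i ^ 2 = 1) (hs : ∀ i, 0 ≤ d.s i) (hc : ∀ i, 0 < d.c i)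
    (lo hi : Fin (n + 1) → ℚ) (hlo : ∀ i, lo i ≤ 0 ∨ AngleEnclosure.lowerTest (d.c i) (lo i) = true)
    (hhi : ∀ i, (d.c i = 1 ∧ 0 ≤ hi i) ∨ AngleEnclosure.upperTest (d.c i) (hi i) = true) {L : ℚ}
    (hVL : -(∑ k : RecastData.LffLine n, wuq d k * eqTermLo d lo hi k.1.1 k.1.2) < L) :
    (certU d lam hlam d.angleOf hν hM hνM hCS hC).V 0 < (2 / (lam : ℝ) + (lam : ℝ) / 2) * (L : ℝ) := by
  have hlam' : (0 : ℝ) < lam := by exact_mod_cast hlam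
  have hc' : (0 : ℝ) < 2 / (lam : ℝ) + (lam : ℝ) / 2 := by positivity
  have hw : ∀ k, 0 ≤ wuq d k := fun k => (hC k.1.1 k.1.2 (ne_of_lt k.2)).le
  have h := neg_sum_lt_of_level_line d hE hc (d.table_le_angleOf hcirc hs lo hlo)
    (d.angleOf_le_table hcirc hs hi hhi) (wuq d) hw hc' hVL
  rw [Certificate.V_zero]
  simp only [wuq_cast] at h
  exact h

end Summit.Ventures.GridStability.Lyapunov.RelativeLff

open Summit.Ventures.GridStability.Lyapunov.RelativeLff

/-! ### NE39L (closed form every λ; certificate of record λ = 1/10) -/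

namespace Summit.Ventures.GridStability.Lyapunov.NE39LLff

/-- ONE rational comparison for the closed form: `−Σ_k C_k·eqTermLo_k < L_U = −67.244`. -/
theorem neg_sum_eqTermLo_lt_L_U :
    -(∑ k : RecastData.LffLine 9, wuq NE39L.data k * eqTermLo NE39L.data lo hi k.1.1 k.1.2) < L_U := by
  decide +kernel

/-- **Non-emptiness of the closed-form level row, every `λ > 0`**: `V_λ(0) < (2/λ + λ/2)·L_U`
(`λ = 1/10`: `V(0) < −1348.2422`). [folklore] -/
theorem V_zero_lt_levelU (lam : ℚ) (hlam : 0 < lam) :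
    (certU lam hlam).V 0 < (2 / (lam : ℝ) + (lam : ℝ) / 2) * (L_U : ℝ) :=
  certU_V_zero_lt_of_level NE39L.data lam hlam _ M_pos nu_lt_Mμ cs_criterion NE39L.data_Cc_pos
    NE39L.data_eqData NE39L.data_circle.1 acute.1 acute.2 lo hi lo_test hi_test neg_sum_eqTermLo_lt_L_U

/-- The synchronous equilibrium (relative state `0`) lies in the polytope of `NE39L.lffSystemU lam`. -/
theorem zero_mem_polytopeU (lam : ℚ) :
    (0 : Fin 9 ⊕ Fin 9 → ℝ) ∈ (NE39L.data.lffSystemU lam NE39L.data.angleOf).polytope :=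
  zero_mem_polytope_of_abs_lt _ (abs_δsu_lt_of_acute NE39L.data acute.1 acute.2)

/-- **Rider for `levelU_roa` / `levelU_synchronisation`**: there is an admissible level `c₀ < (2/λ + λ/2)·L_U`
whose certified set `{y ∈ 𝒫 | V_λ y ≤ c₀}` contains the equilibrium (witness `c₀ = V_λ(0)`). -/
theorem levelU_nonempty (lam : ℚ) (hlam : 0 < lam) :
    ∃ c₀ : ℝ, c₀ < (2 / (lam : ℝ) + (lam : ℝ) / 2) * (L_U : ℝ) ∧
      (0 : Fin 9 ⊕ Fin 9 → ℝ) ∈ (NE39L.data.lffSystemU lam NE39L.data.angleOf).polytope ∧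
      (certU lam hlam).V 0 ≤ c₀ :=
  ⟨_, V_zero_lt_levelU lam hlam, zero_mem_polytopeU lam, le_rfl⟩

/-- ONE rational comparison for the certificate of record: `−Σ_k K_k·eqTermLo_k < L_oso = −467.416`. -/
theorem neg_sum_eqTermLo_lt_L_oso :
    -(∑ k : RecastData.LffLine 9, NE39LLffOso.Kq k * eqTermLo NE39L.data lo hi k.1.1 k.1.2) < L_oso := by
  decide +kernel

/-- **Non-emptiness of the certificate-of-record level row** (cedb541c3cce88c7, `λ = 1/10`):
`V(0) < L_oso = −467.416` (sos-4 float `V(0) ≈ −470.6`). [folklore] -/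
theorem oso_V_zero_lt_level : NE39LLffOso.cert.V 0 < (L_oso : ℝ) := by
  have h := neg_sum_lt_of_level_line NE39L.data NE39L.data_eqData acute.2 lo_le_angleOf angleOf_le_hi
    NE39LLffOso.Kq NE39LLffOso.Kq_nonneg one_pos neg_sum_eqTermLo_lt_L_oso
  rw [Certificate.V_zero]
  simp only [one_mul] at h
  exact h

/-- The equilibrium lies in the polytope of `NE39L.lffSystemU (1/10)`. -/
theorem zero_mem_polytope_oso : (0 : Fin 9 ⊕ Fin 9 → ℝ) ∈ (NE39L.lffSystemU (1 / 10)).polytope :=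
  zero_mem_polytope_of_abs_lt _ NE39LLffOso.abs_δsu_lt

/-- **Rider for `oso_level_roa` / `oso_level_synchronisation`**: an admissible level `c₀ < L_oso` whose
certified set contains the equilibrium exists (witness `c₀ = V(0)`). -/
theorem oso_level_nonempty :
    ∃ c₀ : ℝ, c₀ < (L_oso : ℝ) ∧ (0 : Fin 9 ⊕ Fin 9 → ℝ) ∈ (NE39L.lffSystemU (1 / 10)).polytope ∧
      NE39LLffOso.cert.V 0 ≤ c₀ :=
  ⟨_, oso_V_zero_lt_level, zero_mem_polytope_oso, le_rfl⟩

end Summit.Ventures.GridStability.Lyapunov.NE39LLff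

/-! ### WSCC9L (certificate of record P1 on ordered pairs; 3-line closed form) -/

namespace Summit.Ventures.GridStability.Lyapunov.WSCC9Lff

/-- ONE rational comparison for the certificate of record (ordered pairs, weights `C_ij/2`):
`−Σ_k (C_k/2)·eqTermLo_k < 1657/10000 − 72029/20000 = −3.43575`. -/
theorem neg_sum_eqTermLo_lt_pair :
    -(∑ k : RecastData.LffPair 2, woq WSCC9.postB_relL k *
        eqTermLo WSCC9.postB_relL WSCC9.angleLo WSCC9.angleHi k.1.1 k.1.2) < 1657 / 10000 - 72029 / 20000 := by
  decide +kernel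

/-- **Non-emptiness of the P1 level row (certificate of record, every `λ > 0`)**:
`V_λ(0) < (2/λ + λ/2)·(1657/10000 − 72029/20000)` (`λ = 1/10`: `V(0) < −68.887`). [folklore] -/
theorem V_zero_lt_level (lam : ℚ) (hlam : 0 < lam) :
    (cert lam hlam).V 0 < (2 / (lam : ℝ) + (lam : ℝ) / 2) * ((1657 : ℝ) / 10000 - 72029 / 20000) := by
  have hlam' : (0 : ℝ) < lam := by exact_mod_cast hlam
  have hc' : (0 : ℝ) < 2 / (lam : ℝ) + (lam : ℝ) / 2 := by positivity
  have hw : ∀ k, 0 ≤ woq WSCC9.postB_relL k := fun k =>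
    div_nonneg (WSCC9.postB_relL_Cc_pos k.1.1 k.1.2 k.2).le (by norm_num)
  have h := neg_sum_lt_of_level_pair WSCC9.postB_relL WSCC9.postB_relL_eqData WSCC9.postB_relL_c_pos
    WSCC9.angleLo_le WSCC9.angleOf_le_angleHi (woq WSCC9.postB_relL) hw hc' neg_sum_eqTermLo_lt_pair
  rw [Certificate.V_zero]
  simp only [woq_cast] at h
  push_cast at h
  exact h

/-- The equilibrium lies in the polytope of the ordered-pair presentation. -/
theorem zero_mem_polytope_pair (lam : ℚ) :
    (0 : Fin 2 ⊕ Fin 2 → ℝ) ∈ (System.relativeSwing (fun m : Fin 2 => ((WSCC9.postB_relL.M m.succ : ℚ) : ℝ))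
      ((WSCC9.postB_relL.M 0 : ℚ) : ℝ) (lam : ℝ) (RecastData.lffEo 2) WSCC9.postB_relL.lffWo
      (RecastData.lffδso WSCC9.postB_relL.angleOf)).polytope :=
  zero_mem_polytope_of_abs_lt _ abs_δs_lt

/-- **Rider for `level_roa` / `level_synchronisation`**: an admissible level containing the equilibrium
exists (witness `c₀ = V_λ(0)`). -/
theorem level_nonempty (lam : ℚ) (hlam : 0 < lam) :
    ∃ c₀ : ℝ, c₀ < (2 / (lam : ℝ) + (lam : ℝ) / 2) * ((1657 : ℝ) / 10000 - 72029 / 20000) ∧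
      (0 : Fin 2 ⊕ Fin 2 → ℝ) ∈ (System.relativeSwing (fun m : Fin 2 => ((WSCC9.postB_relL.M m.succ : ℚ) : ℝ))
        ((WSCC9.postB_relL.M 0 : ℚ) : ℝ) (lam : ℝ) (RecastData.lffEo 2) WSCC9.postB_relL.lffWo
        (RecastData.lffδso WSCC9.postB_relL.angleOf)).polytope ∧
      (cert lam hlam).V 0 ≤ c₀ :=
  ⟨_, V_zero_lt_level lam hlam, zero_mem_polytope_pair lam, le_rfl⟩

/-- ONE rational comparison for the 3-line closed form: `−Σ_k C_k·eqTermLo_k < L_U = −327/100`. -/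
theorem neg_sum_eqTermLo_lt_L_U :
    -(∑ k : RecastData.LffLine 2, wuq WSCC9.postB_relL k *
        eqTermLo WSCC9.postB_relL WSCC9.angleLo WSCC9.angleHi k.1.1 k.1.2) < L_U := by
  decide +kernel

/-- **Non-emptiness of the 3-line closed-form level row, every `λ > 0`**: `V_λ(0) < (2/λ + λ/2)·L_U`. [folklore] -/
theorem V_zero_lt_levelU (lam : ℚ) (hlam : 0 < lam) :
    (certU lam hlam).V 0 < (2 / (lam : ℝ) + (lam : ℝ) / 2) * (L_U : ℝ) :=
  certU_V_zero_lt_of_level WSCC9.postB_relL lam hlam _ M_pos nu_lt_Mμ cs_criterion WSCC9.postB_relL_Cc_pos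
    WSCC9.postB_relL_eqData WSCC9.postB_relL_circle.1 WSCC9.postB_relL_s_nonneg WSCC9.postB_relL_c_pos
    WSCC9.angleLo WSCC9.angleHi lo_test hi_test neg_sum_eqTermLo_lt_L_U

/-- The equilibrium lies in the polytope of the 3-line presentation `WSCC9.postB_relL.lffSystemU lam`. -/
theorem zero_mem_polytopeU (lam : ℚ) :
    (0 : Fin 2 ⊕ Fin 2 → ℝ) ∈ (WSCC9.postB_relL.lffSystemU lam WSCC9.postB_relL.angleOf).polytope :=
  zero_mem_polytope_of_abs_lt _
    (abs_δsu_lt_of_acute WSCC9.postB_relL WSCC9.postB_relL_s_nonneg WSCC9.postB_relL_c_pos)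

/-- **Rider for `levelU_roa` / `levelU_synchronisation`** (witness `c₀ = V_λ(0)`). -/
theorem levelU_nonempty (lam : ℚ) (hlam : 0 < lam) :
    ∃ c₀ : ℝ, c₀ < (2 / (lam : ℝ) + (lam : ℝ) / 2) * (L_U : ℝ) ∧
      (0 : Fin 2 ⊕ Fin 2 → ℝ) ∈ (WSCC9.postB_relL.lffSystemU lam WSCC9.postB_relL.angleOf).polytope ∧
      (certU lam hlam).V 0 ≤ c₀ :=
  ⟨_, V_zero_lt_levelU lam hlam, zero_mem_polytopeU lam, le_rfl⟩

end Summit.Ventures.GridStability.Lyapunov.WSCC9Lff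

end
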